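import Literature.RingTheory.HilbertSamuel.NuInvariantLocal
import Literature.RingTheory.HilbertSamuel.TangentConeInitialForms
import HarnessLib

/-!
# The relative `ν*`-invariant `ν*(J, R) = ν*(In_𝔪(J))` (Cossart–Jannsen–Saito 2020, Def. 2.17 (2))

Topic: `Literature/RingTheory/HilbertSamuel`. CJS, LNM 2270, Def. 2.17 (2): for a regular local ring
`R` (`gr_𝔪(R) = k[X_1, …, X_n]` in a regular system of parameters) and an ideal `J ⊂ 𝔪`: "We define
`ν*(J, R)` as the `ν*`-invariant (cf. Definition 2.1) for `In_𝔪(J) ⊂ gr_𝔪(R)`." With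
`In_𝔪(J) = initialIdeal x J` (`TangentConeInitialForms.lean`) and the absolute invariant `nuInvAbs`
(`NuInvariantLocal.lean`, Def. 2.17 (3)):

* `nuInvRel x J i = ν^{i+1}(J, A)` (DEFINITION; any local `A`, generators `x` of `𝔪`);
* `nuInvAbs_eq_nuInv_initialIdeal_bot` — `ν*(𝒪) = ν*(In_𝔫(0))` = `nuInvRel x ⊥`;
* **`nuInvAbs_quotient_eq_nuInvRel`** — for `𝒪 = A/J` and generators `x_1, …, x_e` of `𝔪` whose
  images form a MINIMAL system of generators of `𝔪/J` (`e = emb.dim(A/J)`, i.e. `x` minimal and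
  `J ⊆ 𝔪²`; CJS: `A = R` regular, cf. Rem. 2.9 (b)): **`ν*(A/J) = ν*(J, A)`**
  (`J_{A/J} = In_𝔪(J)` up to the residue field isomorphism `k(A) ≅ k(A/J)`).

## References

* V. Cossart, U. Jannsen, S. Saito, *Desingularization: Invariants and Strategy*, LNM 2270
  (2020), Ch. 2, Def. 2.17 (2), (3), Rem. 2.9 (b). [CossartJannsenSaito2020]
-/

noncomputable section

open IsLocalRing MvPolynomial
open Literature.AlgebraicGeometry.Resolution Literature.RingTheory.MvPolynomial

namespace Literature.RingTheory.HilbertSamuel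

universe u

variable {A : Type u} [CommRing A] [IsLocalRing A] {e : ℕ} (x : Fin e → A)
  (hx : Ideal.span (Set.range x) = maximalIdeal A)

/-- **`ν^{i+1}(J, A)`** (CJS Def. 2.17 (2)): the `ν`-invariant of the ideal of initial forms
`In_𝔪(J) ⊆ k[X_1, …, X_e]` in the generators `x` of `𝔪` (CJS: `A = R` regular, `x` a regular system
of parameters, so that `gr_𝔪(R) = k[X]`). [cite: CossartJannsenSaito2020, Def. 2.17 (2)] -/
def nuInvRel (J : Ideal A) (i : ℕ) : ℕ∞ :=
  nuInv (initialIdeal x J) i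

/-- `ν*(𝒪) = ν*(In_𝔫(0))` in any minimal system of generators. [cite: CossartJannsenSaito2020, Def. 2.17 (3)] -/
theorem nuInvAbs_eq_nuInv_initialIdeal_bot [IsNoetherianRing A] {e : ℕ}
    (he : (maximalIdeal A).spanFinrank = e) (x : Fin e → A)
    (hx : Ideal.span (Set.range x) = maximalIdeal A) (i : ℕ) :
    nuInvAbs A i = nuInvRel x ⊥ i := by
  rw [nuInvAbs_eq' he x hx, tangentConeIdeal_eq_initialIdeal_bot, nuInvRel]

include hx in
/-- **`ν*(A/J) = ν*(J, A)`** when the images of the generators `x` of `𝔪` are a minimal system of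
generators of `𝔪/J` (`e = emb.dim(A/J)`, e.g. `x` minimal and `J ⊆ 𝔪²`; CJS: `A = R` regular,
Def. 2.17 (2) vs (3) with Rem. 2.9 (b)): the tangent cone ideal of `A/J` in the induced generators is
`In_𝔪(J)` up to the residue field isomorphism. [cite: CossartJannsenSaito2020, Def. 2.17] -/
theorem nuInvAbs_quotient_eq_nuInvRel [IsNoetherianRing A] (J : Ideal A) [Nontrivial (A ⧸ J)]
    (he : (maximalIdeal (A ⧸ J)).spanFinrank = e) (i : ℕ) :
    nuInvAbs (A ⧸ J) i = nuInvRel x J i := by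
  rw [nuInvAbs_eq' he (fun j => Ideal.Quotient.mk J (x j)) (span_range_mk_comp_eq x hx J),
    tangentConeIdeal_quotient_eq_map_initialIdeal x hx J, nuInvRel]
  exact nuInv_map_of_bijective _ (residueField_map_mk_bijective J) _ i

end Literature.RingTheory.HilbertSamuel

end
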